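import Summits.BirchSwinnertonDyer.BirchSwinnertonDyer.Theorems.GenusKolyvaginAtTwoK4PosOffCutNonPhantomAtTwoMult
import HarnessLib

/-!
# Route `GenusKolyvaginAtTwo`, kernel items `K4Pos` (stmt-BirchSwinnertonDyer-31469) / `K4Neg` (stmt-31526), LINES 33/34 «twin_bsd_road»,
# stub F4″ `stub_offCutNonPhantomAtTwo`: F4″ IS `E`-INTRINSIC AND DECIDED AT THE PLACE `2` — (NPh_K) at the places over `2` ⟺ a level-2
# witness at `v = 2` over `ℚ`; hence F4″ FAILS at every curve whose Lawson–Wuthrich class is Kummer at `ℚ₂`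

Width seat `bsd-line-gk2-p5` g41 (cell `bsd-f1-sign2`), `--supports stmt-BirchSwinnertonDyer-31469 --as helper`.  THEOREMS ONLY (no definition, no named
fact, no `sorry`).  **BSD is NOT proved by this file; `K4Pos` / `K4Neg` are NOT proved; nothing is closed.**

gk2-p4 g31 proved the EXACTNESS of the level-2 lever for the places over `2N` (`nonPhantom_pow_iff_levelTwoWitness_rat`, any `N` with the Heegner
hypothesis and `2` split).  F4″ (pen g27, LINE 33/34 v1.3) asks the Kummer condition only at the places over `2`; that is the case `N = 1` (the Heegner
hypothesis for `1` is vacuous).  So, on every admissible frame with `2` split: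
* ★ `nonPhantomAtTwoPlaces_iff_levelTwoWitness_two` — «every phantom class of `H¹(K, E[2^L])` (`L ≥ 1`) Kummer at the places of `K` over `2` is zero»
  ⟺ «at some place `v ∋ 2` of `ℚ` (i.e. at `ℚ₂`) no non-zero class of `H¹(ℚ, E[2])` dying on `Γ_{ℚ(E[4])}` is Kummer» — a condition on `E` ALONE,
  decided by one `2`-adic local-image test (LINE 26's instrument «LW2», `α = −Δ·F′(e) ∈? δ₂(E(ℚ₂)/2)`).
* `offCutNonPhantomAtTwo_of_levelTwoWitness_two` — the (⟸) direction in F4″'s shape with the witness as a hypothesis (ANY source: the `2`-multiplicative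
  theorem of `…K4PosOffCutNonPhantomAtTwoMult`, or a per-curve certificate for the `2`-additive cells).
* `not_nonPhantomAtTwoPlaces_of_forall_mem_selmerLocalKer_two` — the NEGATIVE reading: if every non-zero level-4 phantom of `H¹(ℚ, E[2])` IS Kummer at
  `ℚ₂` («no witness at 2»: LINE 26's instrument rows good-at-2 0/18, additive-at-2 16/23), then F4″'s conclusion is FALSE for `(W, K)` at EVERY admissible
  `2`-split frame `K` — such off-cut K₄± cell curves refute `stub_offCutNonPhantomAtTwo` as typed; they are reachable only by the `(NPh)`-free LINES 27/28.
READING for the pen: F4″ = «`2`-adic witness» exactly; TRUE slice ⊇ {multiplicative at `2`} (theorem), FALSE slice ⊇ {no `2`-adic witness} (per curve); restate F4″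
with the witness (or `LW₂(W)`) as a hypothesis and book its complement as (NPh)-unreachable.  BSD is NOT proved by this.

References: [LawsonWuthrich2016] §3, §7.1, §8; [GrossLMS1991] §9 Prop. 9.1; [McCallumLMS1991] §4 (5), Lemma 4.3.
-/

set_option linter.dupNamespace false -- tree convention: `Summit.BirchSwinnertonDyer.BirchSwinnertonDyer.Theorems` (summit = sub-problem)
set_option autoImplicit false

noncomputable section

open scoped Classical

namespace Summit.BirchSwinnertonDyer.BirchSwinnertonDyer.Theorems.GenusExact.Lw2PhantomExclusion

open WeierstrassCurve NumberField Field IsDedekindDomain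
open Literature.NumberTheory.EllipticCurves Literature.NumberTheory.GaloisRepresentations

variable (W : WeierstrassCurve ℚ) [W.IsElliptic] {K : Type} [Field K] [NumberField K]

/-- ★ **F4″ IS DECIDED AT THE PLACE `2` OVER `ℚ`.**  Frame: `ρ_{E,2^n}` onto for all `n`; `K` imaginary quadratic, `d_K` odd, `d_K·(−|Δ|)`, `d_K·(−2|Δ|)`
non-squares, `2` SPLIT in `K`.  Then «for every `L ≥ 1`, every class of `H¹(K, E[2^L])` dying on `Γ_{K(E[2^L])}` and Kummer at every place of `K` over `2` is
zero» (the conclusion of LINE 33/34's `stub_offCutNonPhantomAtTwo`) holds **iff** «there is a place `v ∋ 2` of `ℚ` at which no non-zero class of `H¹(ℚ, E[2])`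
dying on `Γ_{ℚ(E[4])}` is Kummer».  This is gk2-p4 g31's `nonPhantom_pow_iff_levelTwoWitness_rat` at `N = 1` (Heegner hypothesis vacuous).
[cite: LawsonWuthrich2016, §3, §7.1 and §8] [cite: GrossLMS1991, §9 Prop. 9.1] [cite: McCallumLMS1991, §4 Lemma 4.3] -/
theorem nonPhantomAtTwoPlaces_iff_levelTwoWitness_two
    (hρ : ∀ n : ℕ, 0 < n → W.HasSurjectiveModNGaloisRep ((2 : ℤ) ^ n)) (hK : IsImaginaryQuadratic K)
    (hodd : Odd (NumberField.discr K)) (hnsq₁ : ¬ IsSquare ((NumberField.discr K : ℚ) * -|W.Δ|))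
    (hnsq₂ : ¬ IsSquare ((NumberField.discr K : ℚ) * (-(2 * |W.Δ|))))
    (h2K : ((Ideal.span {(2 : ℤ)}).primesOver (𝓞 K)).ncard = 2) :
    (∀ (L : ℕ), 1 ≤ L → ∀ z : galH1Torsion (W.baseChange K) ((2 ^ L : ℕ) : ℤ),
        (∀ ρ' ∈ torsionFixing (W.baseChange K) ((2 ^ L : ℕ) : ℤ), h1Eval (W.baseChange K) ((2 ^ L : ℕ) : ℤ) z ρ' = 0) →
        (∀ w : HeightOneSpectrum (𝓞 K), ((2 : ℕ) : 𝓞 K) ∈ w.asIdeal →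
          z ∈ selmerLocalKer (W.baseChange K) (w.adicCompletion K) ((2 ^ L : ℕ) : ℤ)) → z = 0) ↔
      ∃ v : HeightOneSpectrum (𝓞 ℚ), ((2 : ℕ) : 𝓞 ℚ) ∈ v.asIdeal ∧
        ∀ z : galH1Torsion W 2, z ≠ 0 → (∀ ρ ∈ torsionFixing W 4, h1Eval W 2 z ρ = 0) →
          z ∉ selmerLocalKer W (v.adicCompletion ℚ) 2 := by
  -- the Heegner hypothesis for the level `1` is vacuous (the tree's `satisfiesHeegnerHypothesis_one`, inlined to keep the import cone small)
  have h1 : SatisfiesHeegnerHypothesis 1 K := fun _ hp hp1 ↦ absurd (Nat.dvd_one.mp hp1 ▸ hp) Nat.not_prime_one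
  have h := nonPhantom_pow_iff_levelTwoWitness_rat W hρ hK hodd hnsq₁ hnsq₂ (N := 1) one_ne_zero h1 h2K
  simpa only [mul_one] using h

/-- **F4″ from a level-2 witness at `2` (any source), in F4″'s shape.**  On the frame with `2` split: a place `v ∋ 2` of `ℚ` at which no non-zero level-4
phantom of `H¹(ℚ, E[2])` is Kummer ⟹ every phantom class of `H¹(K, E[2^L])` (`L ≥ 1`) Kummer at the places over `2` is zero.  (The `2`-multiplicative case
is `nonPhantomAtTwo_baseChange_of_hasMultiplicativeReductionAt_two`; for a `2`-additive curve the witness is a per-curve `2`-adic certificate.)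
[cite: LawsonWuthrich2016, §7.1 and §8] -/
theorem offCutNonPhantomAtTwo_of_levelTwoWitness_two
    (hρ : ∀ n : ℕ, 0 < n → W.HasSurjectiveModNGaloisRep ((2 : ℤ) ^ n)) (hK : IsImaginaryQuadratic K)
    (hodd : Odd (NumberField.discr K)) (hnsq₁ : ¬ IsSquare ((NumberField.discr K : ℚ) * -|W.Δ|))
    (hnsq₂ : ¬ IsSquare ((NumberField.discr K : ℚ) * (-(2 * |W.Δ|))))
    (h2K : ((Ideal.span {(2 : ℤ)}).primesOver (𝓞 K)).ncard = 2)
    (hwit : ∃ v : HeightOneSpectrum (𝓞 ℚ), ((2 : ℕ) : 𝓞 ℚ) ∈ v.asIdeal ∧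
      ∀ z : galH1Torsion W 2, z ≠ 0 → (∀ ρ ∈ torsionFixing W 4, h1Eval W 2 z ρ = 0) →
        z ∉ selmerLocalKer W (v.adicCompletion ℚ) 2) :
    ∀ (L : ℕ), 1 ≤ L → ∀ z : galH1Torsion (W.baseChange K) ((2 ^ L : ℕ) : ℤ),
      (∀ ρ' ∈ torsionFixing (W.baseChange K) ((2 ^ L : ℕ) : ℤ), h1Eval (W.baseChange K) ((2 ^ L : ℕ) : ℤ) z ρ' = 0) →
      (∀ w : HeightOneSpectrum (𝓞 K), ((2 : ℕ) : 𝓞 K) ∈ w.asIdeal →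
        z ∈ selmerLocalKer (W.baseChange K) (w.adicCompletion K) ((2 ^ L : ℕ) : ℤ)) → z = 0 :=
  (nonPhantomAtTwoPlaces_iff_levelTwoWitness_two W hρ hK hodd hnsq₁ hnsq₂ h2K).mpr hwit

/-- **The NEGATIVE reading — F4″ FAILS at every «no-witness» curve.**  On the frame with `2` split: if at EVERY place `v ∋ 2` of `ℚ` some non-zero class of
`H¹(ℚ, E[2])` dying on `Γ_{ℚ(E[4])}` IS Kummer (the Lawson–Wuthrich class is locally Selmer at `ℚ₂` — LINE 26's instrument rows «good at 2: 0/18 witnesses»,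
«additive at 2: 16/23 without witness»), then the conclusion of `stub_offCutNonPhantomAtTwo` is FALSE for `(W, K)`: some non-zero phantom class of some
`H¹(K, E[2^L])` is Kummer at all places over `2`.  So F4″ as typed is refuted by any such off-cut K₄± cell curve; those cells are reachable only by
`(NPh)`-free lines. [cite: LawsonWuthrich2016, §7.1 and §8] -/
theorem not_nonPhantomAtTwoPlaces_of_forall_exists_mem_selmerLocalKer_two
    (hρ : ∀ n : ℕ, 0 < n → W.HasSurjectiveModNGaloisRep ((2 : ℤ) ^ n)) (hK : IsImaginaryQuadratic K)
    (hodd : Odd (NumberField.discr K)) (hnsq₁ : ¬ IsSquare ((NumberField.discr K : ℚ) * -|W.Δ|))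
    (hnsq₂ : ¬ IsSquare ((NumberField.discr K : ℚ) * (-(2 * |W.Δ|))))
    (h2K : ((Ideal.span {(2 : ℤ)}).primesOver (𝓞 K)).ncard = 2)
    (hno : ∀ v : HeightOneSpectrum (𝓞 ℚ), ((2 : ℕ) : 𝓞 ℚ) ∈ v.asIdeal →
      ∃ z : galH1Torsion W 2, z ≠ 0 ∧ (∀ ρ ∈ torsionFixing W 4, h1Eval W 2 z ρ = 0) ∧
        z ∈ selmerLocalKer W (v.adicCompletion ℚ) 2) :
    ¬ (∀ (L : ℕ), 1 ≤ L → ∀ z : galH1Torsion (W.baseChange K) ((2 ^ L : ℕ) : ℤ),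
      (∀ ρ' ∈ torsionFixing (W.baseChange K) ((2 ^ L : ℕ) : ℤ), h1Eval (W.baseChange K) ((2 ^ L : ℕ) : ℤ) z ρ' = 0) →
      (∀ w : HeightOneSpectrum (𝓞 K), ((2 : ℕ) : 𝓞 K) ∈ w.asIdeal →
        z ∈ selmerLocalKer (W.baseChange K) (w.adicCompletion K) ((2 ^ L : ℕ) : ℤ)) → z = 0) := by
  intro h
  obtain ⟨v, h2v, hwit⟩ := (nonPhantomAtTwoPlaces_iff_levelTwoWitness_two W hρ hK hodd hnsq₁ hnsq₂ h2K).mp h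
  obtain ⟨z, hz0, hz, hzv⟩ := hno v h2v
  exact hwit z hz0 hz hzv

end Summit.BirchSwinnertonDyer.BirchSwinnertonDyer.Theorems.GenusExact.Lw2PhantomExclusion

end
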